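import Mathlib
import HarnessLib
import Summits.ResolutionOfSingularities.ResolutionOfSingularities.Theorems.WildQuotientsWildQuotientResolutionS1aA1Model
import Summits.ResolutionOfSingularities.ResolutionOfSingularities.Theorems.WildQuotientsWildQuotientResolutionS1aNodeTransport
import Summits.ResolutionOfSingularities.ResolutionOfSingularities.Theorems.WildQuotientsWildQuotientResolutionS1aBlowupChartNode

/-!
# S1a — INSTANCE I-2 (a1), the MODEL NODE of a producer chart of move 1: `σ′ = Φ⁻¹≫sigmaChart≫Φ` acts on the model `k[x_none, x′][1/h]` by F13's rows

[OURS · L1 W4.5c · lead-1 g12; plan-1 R-F15c (I-2 := MT-a1″), X-CERT v1 §3 a1 node `m03c0j1[x2]` (rows), my F13; tools ✓`NodeTransport` (`NodeData.map`, `conj`),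
✓`CobordantTransport` (`chartRingEquivAway`), ✓`A1Model` (`a1ModelEquiv` + pins), ✓`A1Move2Ring` (the abstract move-2 ring algebra these pins feed)] — NOT statements of
the manuscript; counted 0; AI-level work, weaker than expert review. Crux stmt-ResolutionOfSingularities-17941 `CyclicQuotientFourfolds`, line `s1a-logminvertex` v13.

For the a1 datum (`e : A ≃ k[x]`, `τ = e⁻¹σe` with `τx₁ = x₁+x₀, τx₂ = x₂+x₀, τx₃ = x₃+x₁x₂`), the trivial node `(𝒜, e′)` on `A`, the centre `f = e⁻¹(x₀,x₁)`, weights `(2,1)` and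
ANY σ-fixed chart element `y ∈ K_{dbar}`: the producer chart ring `ChartRing 𝒜 f w dbar y` has the model `Φ : ChartRing ≃+* Localization.Away h P`,
`P = MvPolynomial (Option (Fin 4)) k`, `h = a1ModelEquiv e (yT^{dbar})` (`chartRingEquivAway`), and:
* `a1_modelSigma_apply_algebraMap` — `σ′ (algebraMap z) = algebraMap (σ_P z)` with `σ_P := conj (a1ModelEquiv e) σ_R` on `P`; its values on generators
  `a1_sigmaP_X_none/X_some_zero/one/two/three`, `a1_sigmaP_C`: `X none ↦ X none`, `X₀′ ↦ X₀′`, `X₁′ ↦ X₁′ + X₀′·X none`, `x₂ ↦ x₂ + X none²·X₀′`,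
  `x₃ ↦ x₃ + X none·X₁′·x₂`, constants fixed (F13 / X-CERT v1); `a1_sigmaP_h` (`σ_P h = h`), `a1_modelSigma_invSelf` (`σ′` fixes `h⁻¹`);
* `a1_model_closure_eq_top` — the model ring is generated by the images of `X none, X₀′, X₁′, x₂, x₃`, the constants and `h⁻¹` (the `Gfix` of `…A1Move2Ring`);
* `a1_model_degree_X_some_zero/two` — `algebraMap X₀′` has degree `consIndexEquiv (2, 0)` and `algebraMap x₂` degree `0` for the transported grading
  (homogeneity of move 2's centre `(X₀′, x₂)`).
-/

set_option linter.dupNamespace false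

noncomputable section

open Literature.AlgebraicGeometry.Resolution
open scoped LaurentPolynomial
open MvPolynomial
open Summit.ResolutionOfSingularities.ResolutionOfSingularities.Theorems.WildQuotientResolution.S1.CoarseChart
open Summit.ResolutionOfSingularities.ResolutionOfSingularities.Theorems.WildQuotientResolution.S1.CobordantTransport
open Summit.ResolutionOfSingularities.ResolutionOfSingularities.Theorems.WildQuotientResolution.S1.NodeTransport
open Summit.ResolutionOfSingularities.ResolutionOfSingularities.Theorems.WildQuotientResolution.S1.BlowupCharts
open Summit.ResolutionOfSingularities.ResolutionOfSingularities.Theorems.WildQuotientResolution.S1.ReesBigrading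

namespace Summit.ResolutionOfSingularities.ResolutionOfSingularities.Theorems.WildQuotientResolution.S1.KillCert.A1

variable {k : Type} [Field k] {A : Type} [CommRing A]
  (σ : MvPolynomial (Fin 4) k ≃+* MvPolynomial (Fin 4) k) (hC : ∀ a : k, σ (C a) = C a)
  (h0 : σ (X 0) = X 0) (h1 : σ (X 1) = X 1 + X 0) (h2 : σ (X 2) = X 2 + X 0) (h3 : σ (X 3) = X 3 + X 1 * X 2)
  (e : A ≃+* MvPolynomial (Fin 4) k) (τ : A ≃+* A) (hact : ∀ t : A, τ t = e.symm (σ (e t)))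
  {p : ℕ} (hp : 0 < p) (hσp : ∀ x : A, (⇑τ)^[p] x = x)

/-! ## `σ_P = conj (a1ModelEquiv e) σ_R` on the generators of `P` -/

section SigmaP

variable (hσJ : ∀ n : ℕ, ((weightedFiltration (⇑e.symm ∘ ![X 0, X 1] : Fin 2 → A) ![2, 1]).ideal n).map (τ : A →+* A) ≤
    (weightedFiltration (⇑e.symm ∘ ![X 0, X 1] : Fin 2 → A) ![2, 1]).ideal n)

/-- `σ_P (X none) = X none`. -/
theorem a1_sigmaP_X_none : conj (a1ModelEquiv e) (sigmaR τ _ _ hσJ hp hσp) (X none) = X none := by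
  rw [← a1ModelEquiv_s e, conj_apply_map, sigmaR_s]

include hact h0 in
/-- `σ_P X₀′ = X₀′`. -/
theorem a1_sigmaP_X_some_zero : conj (a1ModelEquiv e) (sigmaR τ _ _ hσJ hp hσp) (X (some 0)) = X (some 0) := by
  rw [← a1ModelEquiv_u'_zero e, conj_apply_map]
  congr 1
  have hu0 : cobordantAlgebra.u' (⇑e.symm ∘ ![X 0, X 1] : Fin 2 → A) ![2, 1] 0 =
      ⟨LaurentPolynomial.C (e.symm (X 0)) * LaurentPolynomial.T ((2 : ℕ) : ℤ), (cobordantAlgebra.u' (⇑e.symm ∘ ![X 0, X 1] : Fin 2 → A) ![2, 1] 0).2⟩ := rfl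
  rw [hu0, sigmaR_mk]
  exact Subtype.ext (by change LaurentPolynomial.C (τ (e.symm (X 0))) * _ = LaurentPolynomial.C (e.symm (X 0)) * _; rw [act_symm σ e τ hact, h0])

include hact h1 in
/-- `σ_P X₁′ = X₁′ + X₀′ · X none`. -/
theorem a1_sigmaP_X_some_one : conj (a1ModelEquiv e) (sigmaR τ _ _ hσJ hp hσp) (X (some 1)) = X (some 1) + X (some 0) * X none := by
  have hu := congrArg (conj (a1ModelEquiv e) (sigmaR τ _ _ hσJ hp hσp)) (a1ModelEquiv_u'_one e)
  rw [← hu, conj_apply_map]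
  have h := a1_sigmaR_u'_one_sub σ h1 e τ hact hp hσp hσJ
  rw [sub_eq_iff_eq_add] at h
  rw [h, map_add, map_mul, a1ModelEquiv_u'_one, a1ModelEquiv_u'_zero, a1ModelEquiv_s, add_comm]

include hact h2 in
/-- `σ_P x₂ = x₂ + X none² · X₀′`. -/
theorem a1_sigmaP_X_some_two : conj (a1ModelEquiv e) (sigmaR τ _ _ hσJ hp hσp) (X (some 2)) = X (some 2) + X none ^ 2 * X (some 0) := by
  have hx := congrArg (conj (a1ModelEquiv e) (sigmaR τ _ _ hσJ hp hσp)) (a1ModelEquiv_algebraMap_symm_X_two e)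
  rw [← hx, conj_apply_map, sigmaR_algebraMap, act_symm σ e τ hact, h2, map_add, map_add, map_add, a1ModelEquiv_algebraMap_symm_X_two,
    (a1ModelEquiv_algebraMap_symm_X_zero_one e).1]

include hact h3 in
/-- `σ_P x₃ = x₃ + X none · X₁′ · x₂`. -/
theorem a1_sigmaP_X_some_three : conj (a1ModelEquiv e) (sigmaR τ _ _ hσJ hp hσp) (X (some 3)) = X (some 3) + X none * X (some 1) * X (some 2) := by
  have hx := congrArg (conj (a1ModelEquiv e) (sigmaR τ _ _ hσJ hp hσp)) (a1ModelEquiv_algebraMap_symm_X_three e)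
  rw [← hx, conj_apply_map, sigmaR_algebraMap, act_symm σ e τ hact, h3, map_add, map_mul, map_add, map_mul, map_add, map_mul,
    a1ModelEquiv_algebraMap_symm_X_three, a1ModelEquiv_algebraMap_symm_X_two, (a1ModelEquiv_algebraMap_symm_X_zero_one e).2]

include hact hC in
/-- `σ_P` fixes constants. -/
theorem a1_sigmaP_C (a : k) : conj (a1ModelEquiv e) (sigmaR τ _ _ hσJ hp hσp) (C a) = C a := by
  have hc : a1ModelEquiv e (algebraMap A _ (e.symm (C a))) = C a := by
    rw [a1ModelEquiv_algebraMap, cobordantAlgebra.subst, MvPolynomial.eval₂Hom_C]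
  rw [← hc, conj_apply_map, sigmaR_algebraMap, act_symm σ e τ hact, hC]

variable {m : ℕ} (r : Fin m → ℕ) (𝒜 : (Π j : Fin m, ZMod (r j)) → AddSubgroup A) [GradedRing 𝒜]
  {dbar : ℕ} (y : ↥(𝒜 0)) (hy : y ∈ (traceFiltration 𝒜 (⇑e.symm ∘ ![X 0, X 1] : Fin 2 → A) ![2, 1]).ideal dbar) (hσy : τ (y : A) = y)

include hσy in
/-- `σ_P` fixes the image `h` of the cover element. -/
theorem a1_sigmaP_h : conj (a1ModelEquiv e) (sigmaR τ _ _ hσJ hp hσp) (a1ModelEquiv e (coverElement 𝒜 (⇑e.symm ∘ ![X 0, X 1] : Fin 2 → A) ![2, 1] dbar y hy)) =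
    a1ModelEquiv e (coverElement 𝒜 (⇑e.symm ∘ ![X 0, X 1] : Fin 2 → A) ![2, 1] dbar y hy) := by
  rw [conj_apply_map, sigmaR_coverElement 𝒜 _ _ dbar y hy τ hσJ hp hσp hσy]

/-! ## The model automorphism `σ′ = conj Φ sigmaChart` of the producer chart -/

/-- ★ **`σ′` on the model**: `conj Φ σ_chart (algebraMap z) = algebraMap (σ_P z)` for every `z ∈ P`, with `Φ = chartRingEquivAway … (a1ModelEquiv e)`. -/
theorem a1_modelSigma_apply_algebraMap (z : MvPolynomial (Option (Fin 4)) k) :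
    conj (chartRingEquivAway 𝒜 (⇑e.symm ∘ ![X 0, X 1] : Fin 2 → A) ![2, 1] dbar y hy (a1ModelEquiv e))
        (sigmaChart 𝒜 (⇑e.symm ∘ ![X 0, X 1] : Fin 2 → A) ![2, 1] dbar y hy τ hσJ hp hσp hσy)
        (algebraMap (MvPolynomial (Option (Fin 4)) k) (Localization.Away (a1ModelEquiv e (coverElement 𝒜 (⇑e.symm ∘ ![X 0, X 1] : Fin 2 → A) ![2, 1] dbar y hy))) z) =
      algebraMap (MvPolynomial (Option (Fin 4)) k) _ (conj (a1ModelEquiv e) (sigmaR τ _ _ hσJ hp hσp) z) := by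
  have hz : algebraMap (MvPolynomial (Option (Fin 4)) k) (Localization.Away (a1ModelEquiv e (coverElement 𝒜 (⇑e.symm ∘ ![X 0, X 1] : Fin 2 → A) ![2, 1] dbar y hy))) z =
      chartRingEquivAway 𝒜 (⇑e.symm ∘ ![X 0, X 1] : Fin 2 → A) ![2, 1] dbar y hy (a1ModelEquiv e)
        (algebraMap _ (ChartRing 𝒜 (⇑e.symm ∘ ![X 0, X 1] : Fin 2 → A) ![2, 1] dbar y hy) ((a1ModelEquiv e).symm z)) := by
    rw [chartRingEquivAway_algebraMap, RingEquiv.apply_symm_apply]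
  rw [hz, conj_apply_map, sigmaChart_algebraMap, chartRingEquivAway_algebraMap, conj_apply]

include hσy in
/-- `σ′` fixes the inverted cover element `h⁻¹` of the model. -/
theorem a1_modelSigma_invSelf :
    conj (chartRingEquivAway 𝒜 (⇑e.symm ∘ ![X 0, X 1] : Fin 2 → A) ![2, 1] dbar y hy (a1ModelEquiv e))
        (sigmaChart 𝒜 (⇑e.symm ∘ ![X 0, X 1] : Fin 2 → A) ![2, 1] dbar y hy τ hσJ hp hσp hσy)
        (IsLocalization.Away.invSelf (a1ModelEquiv e (coverElement 𝒜 (⇑e.symm ∘ ![X 0, X 1] : Fin 2 → A) ![2, 1] dbar y hy))) =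
      IsLocalization.Away.invSelf (a1ModelEquiv e (coverElement 𝒜 (⇑e.symm ∘ ![X 0, X 1] : Fin 2 → A) ![2, 1] dbar y hy)) := by
  have hfixh : conj (chartRingEquivAway 𝒜 (⇑e.symm ∘ ![X 0, X 1] : Fin 2 → A) ![2, 1] dbar y hy (a1ModelEquiv e))
      (sigmaChart 𝒜 (⇑e.symm ∘ ![X 0, X 1] : Fin 2 → A) ![2, 1] dbar y hy τ hσJ hp hσp hσy)
      (algebraMap _ (Localization.Away (a1ModelEquiv e (coverElement 𝒜 (⇑e.symm ∘ ![X 0, X 1] : Fin 2 → A) ![2, 1] dbar y hy)))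
        (a1ModelEquiv e (coverElement 𝒜 (⇑e.symm ∘ ![X 0, X 1] : Fin 2 → A) ![2, 1] dbar y hy))) =
      algebraMap _ _ (a1ModelEquiv e (coverElement 𝒜 (⇑e.symm ∘ ![X 0, X 1] : Fin 2 → A) ![2, 1] dbar y hy)) := by
    rw [a1_modelSigma_apply_algebraMap, a1_sigmaP_h e τ hp hσp hσJ r 𝒜 y hy hσy]
  have hunit := IsLocalization.Away.mul_invSelf (S := Localization.Away (a1ModelEquiv e (coverElement 𝒜 (⇑e.symm ∘ ![X 0, X 1] : Fin 2 → A) ![2, 1] dbar y hy)))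
    (a1ModelEquiv e (coverElement 𝒜 (⇑e.symm ∘ ![X 0, X 1] : Fin 2 → A) ![2, 1] dbar y hy))
  have h1 : algebraMap _ (Localization.Away (a1ModelEquiv e (coverElement 𝒜 (⇑e.symm ∘ ![X 0, X 1] : Fin 2 → A) ![2, 1] dbar y hy)))
        (a1ModelEquiv e (coverElement 𝒜 (⇑e.symm ∘ ![X 0, X 1] : Fin 2 → A) ![2, 1] dbar y hy)) *
      conj (chartRingEquivAway 𝒜 (⇑e.symm ∘ ![X 0, X 1] : Fin 2 → A) ![2, 1] dbar y hy (a1ModelEquiv e))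
        (sigmaChart 𝒜 (⇑e.symm ∘ ![X 0, X 1] : Fin 2 → A) ![2, 1] dbar y hy τ hσJ hp hσp hσy)
        (IsLocalization.Away.invSelf (a1ModelEquiv e (coverElement 𝒜 (⇑e.symm ∘ ![X 0, X 1] : Fin 2 → A) ![2, 1] dbar y hy))) = 1 := by
    have := congrArg (conj (chartRingEquivAway 𝒜 (⇑e.symm ∘ ![X 0, X 1] : Fin 2 → A) ![2, 1] dbar y hy (a1ModelEquiv e))
      (sigmaChart 𝒜 (⇑e.symm ∘ ![X 0, X 1] : Fin 2 → A) ![2, 1] dbar y hy τ hσJ hp hσp hσy)) hunit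
    rw [map_mul, map_one, hfixh] at this
    exact this
  calc conj (chartRingEquivAway 𝒜 (⇑e.symm ∘ ![X 0, X 1] : Fin 2 → A) ![2, 1] dbar y hy (a1ModelEquiv e))
        (sigmaChart 𝒜 (⇑e.symm ∘ ![X 0, X 1] : Fin 2 → A) ![2, 1] dbar y hy τ hσJ hp hσp hσy)
        (IsLocalization.Away.invSelf (a1ModelEquiv e (coverElement 𝒜 (⇑e.symm ∘ ![X 0, X 1] : Fin 2 → A) ![2, 1] dbar y hy)))
      = (algebraMap _ (Localization.Away (a1ModelEquiv e (coverElement 𝒜 (⇑e.symm ∘ ![X 0, X 1] : Fin 2 → A) ![2, 1] dbar y hy)))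
          (a1ModelEquiv e (coverElement 𝒜 (⇑e.symm ∘ ![X 0, X 1] : Fin 2 → A) ![2, 1] dbar y hy)) *
          IsLocalization.Away.invSelf (a1ModelEquiv e (coverElement 𝒜 (⇑e.symm ∘ ![X 0, X 1] : Fin 2 → A) ![2, 1] dbar y hy))) *
        conj (chartRingEquivAway 𝒜 (⇑e.symm ∘ ![X 0, X 1] : Fin 2 → A) ![2, 1] dbar y hy (a1ModelEquiv e))
          (sigmaChart 𝒜 (⇑e.symm ∘ ![X 0, X 1] : Fin 2 → A) ![2, 1] dbar y hy τ hσJ hp hσp hσy)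
          (IsLocalization.Away.invSelf (a1ModelEquiv e (coverElement 𝒜 (⇑e.symm ∘ ![X 0, X 1] : Fin 2 → A) ![2, 1] dbar y hy))) := by rw [hunit, one_mul]
    _ = (algebraMap _ (Localization.Away (a1ModelEquiv e (coverElement 𝒜 (⇑e.symm ∘ ![X 0, X 1] : Fin 2 → A) ![2, 1] dbar y hy)))
          (a1ModelEquiv e (coverElement 𝒜 (⇑e.symm ∘ ![X 0, X 1] : Fin 2 → A) ![2, 1] dbar y hy)) *
        conj (chartRingEquivAway 𝒜 (⇑e.symm ∘ ![X 0, X 1] : Fin 2 → A) ![2, 1] dbar y hy (a1ModelEquiv e))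
          (sigmaChart 𝒜 (⇑e.symm ∘ ![X 0, X 1] : Fin 2 → A) ![2, 1] dbar y hy τ hσJ hp hσp hσy)
          (IsLocalization.Away.invSelf (a1ModelEquiv e (coverElement 𝒜 (⇑e.symm ∘ ![X 0, X 1] : Fin 2 → A) ![2, 1] dbar y hy)))) *
        IsLocalization.Away.invSelf (a1ModelEquiv e (coverElement 𝒜 (⇑e.symm ∘ ![X 0, X 1] : Fin 2 → A) ![2, 1] dbar y hy)) := by ring
    _ = IsLocalization.Away.invSelf (a1ModelEquiv e (coverElement 𝒜 (⇑e.symm ∘ ![X 0, X 1] : Fin 2 → A) ![2, 1] dbar y hy)) := by rw [h1, one_mul]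

end SigmaP

/-! ## Generation of the model ring -/

/-- `P = k[x_none, x′]` is generated, as a ring, by the constants and the variables. -/
theorem closure_range_C_union_range_X_option :
    Subring.closure (Set.range (C : k → MvPolynomial (Option (Fin 4)) k) ∪ Set.range (X : Option (Fin 4) → MvPolynomial (Option (Fin 4)) k)) = ⊤ := by
  suffices h : ∀ z : MvPolynomial (Option (Fin 4)) k,
      z ∈ Subring.closure (Set.range (C : k → MvPolynomial (Option (Fin 4)) k) ∪ Set.range (X : Option (Fin 4) → MvPolynomial (Option (Fin 4)) k)) from
    top_le_iff.mp fun z _ => h z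
  intro z
  induction z using MvPolynomial.induction_on with
  | C a => exact Subring.subset_closure (Or.inl ⟨a, rfl⟩)
  | add p q hp hq => exact add_mem hp hq
  | mul_X p i hp => exact mul_mem hp (Subring.subset_closure (Or.inr ⟨i, rfl⟩))

/-- ★ **Generation of the model of the producer chart ring**: `Localization.Away h P` is generated by the images of `X none, X₀′, X₁′, x₂, x₃`, together with
the constants and `h⁻¹` (all of which are `σ′`-fixed). [OURS · L1 W4.5c] -/
theorem a1_model_closure_eq_top (hh : MvPolynomial (Option (Fin 4)) k) :
    Subring.closure (({algebraMap (MvPolynomial (Option (Fin 4)) k) (Localization.Away hh) (X none), algebraMap (MvPolynomial (Option (Fin 4)) k) (Localization.Away hh) (X (some 0)),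
        algebraMap (MvPolynomial (Option (Fin 4)) k) (Localization.Away hh) (X (some 1)), algebraMap (MvPolynomial (Option (Fin 4)) k) (Localization.Away hh) (X (some 2)), algebraMap (MvPolynomial (Option (Fin 4)) k) (Localization.Away hh) (X (some 3))} :
        Set (Localization.Away hh)) ∪
      ({IsLocalization.Away.invSelf hh} ∪ Set.range (algebraMap k (Localization.Away hh)))) = ⊤ := by
  set S := Subring.closure (({algebraMap (MvPolynomial (Option (Fin 4)) k) (Localization.Away hh) (X none), algebraMap (MvPolynomial (Option (Fin 4)) k) (Localization.Away hh) (X (some 0)),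
        algebraMap (MvPolynomial (Option (Fin 4)) k) (Localization.Away hh) (X (some 1)), algebraMap (MvPolynomial (Option (Fin 4)) k) (Localization.Away hh) (X (some 2)), algebraMap (MvPolynomial (Option (Fin 4)) k) (Localization.Away hh) (X (some 3))} :
        Set (Localization.Away hh)) ∪
      ({IsLocalization.Away.invSelf hh} ∪ Set.range (algebraMap k (Localization.Away hh)))) with hS
  -- the image of `P` lies in `S`
  have hP : ∀ z : MvPolynomial (Option (Fin 4)) k, algebraMap (MvPolynomial (Option (Fin 4)) k) (Localization.Away hh) z ∈ S := by
    intro z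
    induction z using MvPolynomial.induction_on with
    | C a =>
      refine Subring.subset_closure (Or.inr (Or.inr ⟨a, ?_⟩))
      rw [IsScalarTower.algebraMap_apply k (MvPolynomial (Option (Fin 4)) k) (Localization.Away hh) a, MvPolynomial.algebraMap_eq]
    | add p q hp hq => rw [map_add]; exact add_mem hp hq
    | mul_X p i hp =>
      rw [map_mul]
      refine mul_mem hp (Subring.subset_closure (Or.inl ?_))
      rcases i with _ | i
      · simp
      · fin_cases i <;> simp
  refine top_le_iff.mp fun z _ => ?_
  obtain ⟨a, ⟨_, n, rfl⟩, rfl⟩ := IsLocalization.exists_mk'_eq (Submonoid.powers hh) z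
  rw [← algebraMap_mul_invSelf_pow_eq_mk' (hh := hh) a n]
  have hinv : IsLocalization.Away.invSelf hh ∈ S :=
    Subring.subset_closure (Set.mem_union_right _ (Set.mem_union_left _ (Set.mem_singleton _)))
  exact Subring.mul_mem S (hP a) (Subring.pow_mem S hinv n)
where
  /-- `a / hⁿ = a · (h⁻¹)ⁿ` in `Localization.Away h`. -/
  algebraMap_mul_invSelf_pow_eq_mk' {hh : MvPolynomial (Option (Fin 4)) k} (a : MvPolynomial (Option (Fin 4)) k) (n : ℕ) :
      algebraMap (MvPolynomial (Option (Fin 4)) k) (Localization.Away hh) a * IsLocalization.Away.invSelf hh ^ n =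
        IsLocalization.mk' (Localization.Away hh) a (⟨hh ^ n, n, rfl⟩ : Submonoid.powers hh) := by
    rw [IsLocalization.eq_mk'_iff_mul_eq]
    have h1 : IsLocalization.Away.invSelf hh * algebraMap (MvPolynomial (Option (Fin 4)) k) (Localization.Away hh) hh = 1 := by
      rw [mul_comm]; exact IsLocalization.Away.mul_invSelf _
    change _ * algebraMap (MvPolynomial (Option (Fin 4)) k) (Localization.Away hh) (hh ^ n) = _
    rw [map_pow, mul_assoc, ← mul_pow, h1, one_pow, mul_one]

/-! ## Degrees of the centre of move 2 in the transported grading -/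

section Degrees

variable {m : ℕ} (r : Fin m → ℕ) (𝒜 : (Π j : Fin m, ZMod (r j)) → AddSubgroup A) [GradedRing 𝒜]
  (hf : ∀ i, (⇑e.symm ∘ ![X 0, X 1] : Fin 2 → A) i ∈ 𝒜 ((fun _ => (0 : Π j : Fin m, ZMod (r j))) i)) (hx2 : e.symm (X 2) ∈ 𝒜 0)
  {dbar : ℕ} (y : ↥(𝒜 0)) (hy : y ∈ (traceFiltration 𝒜 (⇑e.symm ∘ ![X 0, X 1] : Fin 2 → A) ![2, 1]).ideal dbar)

include hf in
/-- `algebraMap X₀′` has degree `consIndexEquiv r (2, 0)` for the grading transported along `Φ`. -/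
theorem a1_model_degree_X_some_zero :
    letI := chartNodeGradedRing r 𝒜 (⇑e.symm ∘ ![X 0, X 1] : Fin 2 → A) ![2, 1] hf dbar y hy
    algebraMap (MvPolynomial (Option (Fin 4)) k) (Localization.Away (a1ModelEquiv e (coverElement 𝒜 (⇑e.symm ∘ ![X 0, X 1] : Fin 2 → A) ![2, 1] dbar y hy))) (X (some 0)) ∈
      mapGrading (chartNodeGrading r 𝒜 (⇑e.symm ∘ ![X 0, X 1] : Fin 2 → A) ![2, 1] hf dbar y hy)
        (chartRingEquivAway 𝒜 (⇑e.symm ∘ ![X 0, X 1] : Fin 2 → A) ![2, 1] dbar y hy (a1ModelEquiv e)) (ProducerStep.consIndexEquiv r ((2 : ℤ), 0)) := by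
  letI := chartNodeGradedRing r 𝒜 (⇑e.symm ∘ ![X 0, X 1] : Fin 2 → A) ![2, 1] hf dbar y hy
  have hz : algebraMap (MvPolynomial (Option (Fin 4)) k) (Localization.Away (a1ModelEquiv e (coverElement 𝒜 (⇑e.symm ∘ ![X 0, X 1] : Fin 2 → A) ![2, 1] dbar y hy))) (X (some 0)) =
      chartRingEquivAway 𝒜 (⇑e.symm ∘ ![X 0, X 1] : Fin 2 → A) ![2, 1] dbar y hy (a1ModelEquiv e)
        (algebraMap _ (ChartRing 𝒜 (⇑e.symm ∘ ![X 0, X 1] : Fin 2 → A) ![2, 1] dbar y hy) (cobordantAlgebra.u' (⇑e.symm ∘ ![X 0, X 1] : Fin 2 → A) ![2, 1] 0)) := by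
    rw [chartRingEquivAway_algebraMap, a1ModelEquiv_u'_zero]
  rw [hz, map_mem_mapGrading_iff]
  change _ ∈ chartGrading 𝒜 (⇑e.symm ∘ ![X 0, X 1] : Fin 2 → A) ![2, 1] hf dbar y hy ((ProducerStep.consIndexEquiv r).symm (ProducerStep.consIndexEquiv r ((2 : ℤ), 0)))
  rw [AddEquiv.symm_apply_apply]
  have h := algebraMap_mem_chartGrading 𝒜 (⇑e.symm ∘ ![X 0, X 1] : Fin 2 → A) ![2, 1] hf dbar y hy
    (u'_mem_reesPiece 𝒜 (⇑e.symm ∘ ![X 0, X 1] : Fin 2 → A) (δ := fun _ => 0) ![2, 1] hf 0)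
  exact h

include hf hx2 in
/-- `algebraMap x₂` has degree `0` for the grading transported along `Φ`. -/
theorem a1_model_degree_X_some_two :
    letI := chartNodeGradedRing r 𝒜 (⇑e.symm ∘ ![X 0, X 1] : Fin 2 → A) ![2, 1] hf dbar y hy
    algebraMap (MvPolynomial (Option (Fin 4)) k) (Localization.Away (a1ModelEquiv e (coverElement 𝒜 (⇑e.symm ∘ ![X 0, X 1] : Fin 2 → A) ![2, 1] dbar y hy))) (X (some 2)) ∈
      mapGrading (chartNodeGrading r 𝒜 (⇑e.symm ∘ ![X 0, X 1] : Fin 2 → A) ![2, 1] hf dbar y hy)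
        (chartRingEquivAway 𝒜 (⇑e.symm ∘ ![X 0, X 1] : Fin 2 → A) ![2, 1] dbar y hy (a1ModelEquiv e)) 0 := by
  letI := chartNodeGradedRing r 𝒜 (⇑e.symm ∘ ![X 0, X 1] : Fin 2 → A) ![2, 1] hf dbar y hy
  have hz : algebraMap (MvPolynomial (Option (Fin 4)) k) (Localization.Away (a1ModelEquiv e (coverElement 𝒜 (⇑e.symm ∘ ![X 0, X 1] : Fin 2 → A) ![2, 1] dbar y hy))) (X (some 2)) =
      chartRingEquivAway 𝒜 (⇑e.symm ∘ ![X 0, X 1] : Fin 2 → A) ![2, 1] dbar y hy (a1ModelEquiv e)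
        (algebraMap _ (ChartRing 𝒜 (⇑e.symm ∘ ![X 0, X 1] : Fin 2 → A) ![2, 1] dbar y hy) (algebraMap A ↥(cobordantAlgebra (⇑e.symm ∘ ![X 0, X 1] : Fin 2 → A) ![2, 1]) (e.symm (X 2)))) := by
    rw [chartRingEquivAway_algebraMap, a1ModelEquiv_algebraMap_symm_X_two]
  rw [hz, map_mem_mapGrading_iff]
  change _ ∈ chartGrading 𝒜 (⇑e.symm ∘ ![X 0, X 1] : Fin 2 → A) ![2, 1] hf dbar y hy ((ProducerStep.consIndexEquiv r).symm 0)
  rw [map_zero]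
  exact algebraMap_mem_chartGrading 𝒜 (⇑e.symm ∘ ![X 0, X 1] : Fin 2 → A) ![2, 1] hf dbar y hy (algebraMap_mem_reesPiece 𝒜 _ _ hx2)

end Degrees

end Summit.ResolutionOfSingularities.ResolutionOfSingularities.Theorems.WildQuotientResolution.S1.KillCert.A1

end
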